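import Literature.Probability.RandomPlanarGeometry.SAWLoopErasureKestenRenewalGreenTableHigh
import HarnessLib

/-!
# The SRW Green function near the origin: exact parity-class heads and two-sided rational enclosures (`d ≥ 3`)

Topic `Literature/Probability/RandomPlanarGeometry` (Hara–Slade–Sokal loop-erasure lane; the inputs of the `(2̃,1)` row
of HSS93 Table 2).  HSS93 Appendix B evaluates the massless lattice Green function `C₀(0,x;1/2d) = G(x) = I_{1,0}(x)`
at the origin and its neighbours numerically and feeds the values into the memory-2 linear system (3.13)–(3.14).  The
tree's `SAWLoopErasureKestenRenewalGreenTable(.High)` certifies `G(0) ≤ B_d` (`GreenCert.srwI_one_le_certB`,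
`3 ≤ d ≤ 21`) from the exact even-time head `GreenCert.partialQ d K = Σ_{m<K} p_{2m}(0)` (the SEEDCERT hat kernel
`SeedCert.wHatFold` on the all-zero magnitude list).  This module runs the SAME kernel at a general site with
non-negative coordinate list `cs` (`|x|₁ = s = Σ cs`):

* `GreenNbhd.exactTableAt K cs` / `GreenNbhd.partialQAt d K cs` — the hat table and the exact class head
  `Σ_{k<K} p_{2k+s}(x) = Σ_{k<K} c_{2k+s}(x)/(2d)^{2k+s}` as a rational (`partialQAt_eq`, `partialQAt_cast`, from
  `SeedCert.wHatFold_spec`);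
* `srwLaw_eq_zero_of_ne_class` / `sum_range_srwLaw_eq_sum_class` — parity and support: `p_m(x) = 0` unless
  `m = 2i + s`, so `Σ_{n<2K+s} p_n(x) = Σ_{k<K} p_{2k+s}(x)` (`SeedCert.G_eq_zero_of_not_support`);
* **`partialQAt_le_srwI_one` / `srwI_one_le_partialQAt_add`** — the two-sided enclosure
  `partialQAt d K cs ≤ G(x) ≤ partialQAt d K cs + (G(0) − partialQ d K)` (`d ≥ 3`): the upper bound is the
  origin-tail bound `I_{1,2K+s}(x) ≤ I_{1,2K+s}(0)` (`srwI_one_le_sum_add_zero`) plus monotonicity of the origin head;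
* **`srwI_one_bounds`** / `srwI_one_zero_bounds` — the enclosure from DECIDED rational literals
  `lo ≤ partialQAt d K cs ≤ hi`, `l0 ≤ partialQ d K` and the tree's `G(0) ≤ B_d` (`3 ≤ d ≤ 21`):
  `lo ≤ G(x) ≤ hi + (B_d − l0)`; `coordD_of_fin` discharges the coordinate hypothesis for a concrete site.

The per-dimension tables (`d = 4, 5, 6`, the seven classes `|x|₁ ≤ 3`) are separate modules that prove the literal
bounds by `decide +kernel` and instantiate `srwI_one_bounds`.  All statements here are `d`-generic; no numerics.

References: [HSS93] T. Hara, G. Slade, A. D. Sokal, J. Stat. Phys. 72 (1993) 479–517, arXiv:hep-lat/9302003,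
Appendix B p. 32 (numerical Green functions at the origin and its neighbours), Table 4 p. 28 (`C₀(0,0;1/2d)`);
tree: `GreenCert.partialQ_cast`, `GreenCert.srwI_one_le_certB`, `SeedCert.wHatFold_spec`.
-/

namespace Literature.Probability.RandomPlanarGeometry.SAW.Zd.LoopErasure

open Finset
open scoped Nat
open Literature.Barriers.CriticalPhenomena.LongRangePhi4 (srwLaw srwLaw_nonneg)
open Literature.Probability.FitznerVanDerHofstad2017
open Literature.Probability.FitznerVanDerHofstad2017.SrwCount (coordD G srwCount srwLaw_eq_srwCount_div
  sum_map_range)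
open Literature.Probability.FitznerVanDerHofstad2017.SeedCert (wHatFold prodRange wHatFold_spec
  G_eq_zero_of_not_support Asum Asum_length)

variable {d : ℕ}

namespace GreenNbhd

/-! ### §1 The exact class head from the SEEDCERT hat kernel -/

/-- The hat table `[Ŵ_0, …, Ŵ_K]`, `Ŵ_k = (2K+s)! · c_{2k+s}(x)/(2k+s)!` (`s = Σ cs`), of the walk counts to a site
with non-negative coordinate list `cs` (`SeedCert.wHatFold`). [folklore] -/
def exactTableAt (K : ℕ) (cs : List ℕ) : List ℕ := wHatFold (prodRange 0 (2 * K + cs.sum)) K cs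

/-- The exact class head `Σ_{k<K} c_{2k+s}(x)/(2d)^{2k+s}` (`s = Σ cs`) as a rational. [folklore] -/
def partialQAt (d K : ℕ) (cs : List ℕ) : ℚ :=
  ((List.range K).map fun k =>
      ((exactTableAt K cs).getD k 0 : ℚ) * ((2 * k + cs.sum)! : ℚ) / (2 * d : ℚ) ^ (2 * k + cs.sum)).sum /
    ((2 * K + cs.sum)! : ℚ)

variable {x : Fin d → ℤ} {cs : List ℕ}

/-- A concrete site's coordinate hypothesis: `x_i = cs_i` on `Fin d` and `|cs| = d` give `coordD x i = cs_i` for all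
`i : ℕ`. [cite: HaraSladeSokal1993, App. A.1 p. 27 (the sites x at which C₀(0,x) is evaluated); lane plumbing] -/
theorem coordD_of_fin (hlen : cs.length = d) (h : ∀ i : Fin d, x i = ((cs.getD i 0 : ℕ) : ℤ)) (i : ℕ) :
    coordD x i = ((cs.getD i 0 : ℕ) : ℤ) := by
  unfold coordD
  split_ifs with hi
  · exact h ⟨i, hi⟩
  · rw [List.getD_eq_default _ _ (by omega)]; rfl

/-- `partialQAt d K cs = Σ_{k<K} c_{2k+s}(x)/(2d)^{2k+s}` for a site `x` with coordinates `cs` (`|cs| = d`).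
[cite: HaraSladeSokal1993, Appendix B p. 32 (Green functions at the origin and its neighbours); lane certificate] -/
theorem partialQAt_eq (hcs : ∀ i, coordD x i = ((cs.getD i 0 : ℕ) : ℤ)) (hlen : cs.length = d) (K : ℕ) :
    partialQAt d K cs =
      ∑ k ∈ range K, (srwCount d (2 * k + cs.sum) x : ℚ) / (2 * d : ℚ) ^ (2 * k + cs.sum) := by
  have hspec := (wHatFold_spec hcs (Mh := 2 * K + cs.sum) (K := K) le_rfl).2
  unfold partialQAt
  rw [sum_map_range, Finset.sum_div]
  refine Finset.sum_congr rfl fun k hk => ?_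
  have hk' : k ≤ K := (mem_range.1 hk).le
  have hW : ((exactTableAt K cs).getD k 0 : ℚ) =
      ((2 * K + cs.sum)! : ℚ) * (G x cs.length (2 * k + cs.sum) : ℚ) / ((2 * k + cs.sum)! : ℚ) := hspec k hk'
  rw [hW, hlen, srwCount]
  have h1 : ((2 * K + cs.sum)! : ℚ) ≠ 0 := by positivity
  have h2 : ((2 * k + cs.sum)! : ℚ) ≠ 0 := by positivity
  field_simp

/-- **The exact class head is the kernel value**: `(partialQAt d K cs : ℝ) = Σ_{k<K} p_{2k+s}(x)`.
[cite: HaraSladeSokal1993, Appendix B p. 32 (Green functions at the origin and its neighbours); lane certificate] -/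
theorem partialQAt_cast (hcs : ∀ i, coordD x i = ((cs.getD i 0 : ℕ) : ℤ)) (hlen : cs.length = d) (K : ℕ) :
    ((partialQAt d K cs : ℚ) : ℝ) = ∑ k ∈ range K, srwLaw d (2 * k + cs.sum) x := by
  rw [partialQAt_eq hcs hlen]
  push_cast
  exact Finset.sum_congr rfl fun k _ => (srwLaw_eq_srwCount_div _ _).symm

/-! ### §2 Parity and support: the full head over times `< 2K + s` is the class head -/

/-- **Parity / support**: `p_m(x) = 0` unless `m = 2i + |x|₁` for some `i`.
[cite: HaraSladeSokal1993, Appendix B p. 32 (Green functions at the origin and its neighbours); lane certificate] -/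
theorem srwLaw_eq_zero_of_ne_class (hcs : ∀ i, coordD x i = ((cs.getD i 0 : ℕ) : ℤ)) (hlen : cs.length = d)
    {m : ℕ} (h : ∀ i, m ≠ 2 * i + cs.sum) : srwLaw d m x = 0 := by
  have h0 : srwCount d m x = 0 := by
    have := G_eq_zero_of_not_support hcs cs.length m (by rwa [Asum_length])
    rwa [hlen] at this
  rw [srwLaw_eq_srwCount_div, h0, Nat.cast_zero, zero_div]

/-- **The full head equals the class head**: `Σ_{n < 2K+s} p_n(x) = Σ_{k<K} p_{2k+s}(x)` (`s = |x|₁`).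
[cite: HaraSladeSokal1993, Appendix B p. 32 (Green functions at the origin and its neighbours); lane certificate] -/
theorem sum_range_srwLaw_eq_sum_class (hcs : ∀ i, coordD x i = ((cs.getD i 0 : ℕ) : ℤ)) (hlen : cs.length = d)
    (K : ℕ) : ∑ n ∈ range (2 * K + cs.sum), srwLaw d n x = ∑ k ∈ range K, srwLaw d (2 * k + cs.sum) x := by
  let e : ℕ ↪ ℕ := ⟨fun k => 2 * k + cs.sum, fun a b hab => by simpa using hab⟩
  have hmap : ∑ k ∈ range K, srwLaw d (2 * k + cs.sum) x = ∑ n ∈ (range K).map e, srwLaw d n x := by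
    rw [Finset.sum_map]; rfl
  rw [hmap]
  symm
  refine Finset.sum_subset (fun n hn => ?_) (fun n hn hnot => ?_)
  · rw [Finset.mem_map] at hn
    obtain ⟨k, hk, rfl⟩ := hn
    rw [mem_range] at hk ⊢
    show 2 * k + cs.sum < 2 * K + cs.sum
    omega
  · refine srwLaw_eq_zero_of_ne_class hcs hlen fun i hi => hnot ?_
    rw [Finset.mem_map]
    refine ⟨i, ?_, hi.symm⟩
    rw [mem_range] at hn ⊢
    omega

/-! ### §3 The two-sided enclosure of `G(x)` -/

/-- **Lower enclosure**: `partialQAt d K cs ≤ G(x) = I_{1,0}(x)` (`d ≥ 3`; a head of the non-negative series).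
[cite: HaraSladeSokal1993, Appendix B p. 32 (Green functions at the origin and its neighbours); lane certificate] -/
theorem partialQAt_le_srwI_one (hd : 3 ≤ d) (hcs : ∀ i, coordD x i = ((cs.getD i 0 : ℕ) : ℤ))
    (hlen : cs.length = d) (K : ℕ) : ((partialQAt d K cs : ℚ) : ℝ) ≤ srwI d 1 0 x := by
  rw [partialQAt_cast hcs hlen, ← sum_range_srwLaw_eq_sum_class hcs hlen K,
    srwI_one_eq_sum_add hd 0 (2 * K + cs.sum) x]
  simp only [zero_add]
  have := srwI_nonneg (d := d) 1 (by omega) (2 * K + cs.sum) x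
  linarith

/-- The origin head is monotone in the cut: `partialQ d K = Σ_{n<2K} p_n(0) ≤ Σ_{n<N} p_n(0)` for `2K ≤ N`.
[cite: HaraSladeSokal1993, Appendix A.1 Table 4 p. 28 (C₀(0,0;1/2d)); lane certificate] -/
theorem partialQ_cast_le_sum_range (K : ℕ) {N : ℕ} (hN : 2 * K ≤ N) :
    ((GreenCert.partialQ d K : ℚ) : ℝ) ≤ ∑ n ∈ range N, srwLaw d n (0 : Fin d → ℤ) := by
  have hcs0 : ∀ i, coordD (0 : Fin d → ℤ) i = (((List.replicate d 0).getD i 0 : ℕ) : ℤ) := fun i => by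
    simp [coordD]
  have h0 := sum_range_srwLaw_eq_sum_class hcs0 (List.length_replicate ..) K
  simp only [List.sum_replicate, smul_zero, add_zero] at h0
  rw [GreenCert.partialQ_cast, ← h0]
  exact Finset.sum_le_sum_of_subset_of_nonneg (Finset.range_mono hN) fun i _ _ => srwLaw_nonneg _ _

/-- **Upper enclosure**: `G(x) ≤ partialQAt d K cs + (G(0) − partialQ d K)` (`d ≥ 3`): the tail beyond time
`2K + s` at `x` is at most the tail at the origin (`srwI_one_le_sum_add_zero`), which is `G(0)` minus a head
dominating `partialQ d K`.
[cite: HaraSladeSokal1993, Appendix B p. 32 (Green functions at the origin and its neighbours); lane certificate] -/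
theorem srwI_one_le_partialQAt_add (hd : 3 ≤ d) (hcs : ∀ i, coordD x i = ((cs.getD i 0 : ℕ) : ℤ))
    (hlen : cs.length = d) (K : ℕ) :
    srwI d 1 0 x ≤ ((partialQAt d K cs : ℚ) : ℝ) + (srwI d 1 0 0 - ((GreenCert.partialQ d K : ℚ) : ℝ)) := by
  have h1 := srwI_one_le_sum_add_zero hd 0 (2 * K + cs.sum) x
  simp only [zero_add] at h1
  rw [sum_range_srwLaw_eq_sum_class hcs hlen K, ← partialQAt_cast hcs hlen] at h1
  have h2 := srwI_one_shift_zero_eq hd 0 (2 * K + cs.sum)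
  simp only [zero_add] at h2
  have h3 := partialQ_cast_le_sum_range (d := d) K (N := 2 * K + cs.sum) (by omega)
  linarith

/-- **Enclosure from decided literals**: `lo ≤ partialQAt d K cs ≤ hi` and `l0 ≤ partialQ d K` (rational facts,
decidable by kernel evaluation) together with the tree's `G(0) ≤ B_d` (`3 ≤ d ≤ 21`) give
`lo ≤ G(x) ≤ hi + (B_d − l0)`.
[cite: HaraSladeSokal1993, Appendix B p. 32 (Green functions at the origin and its neighbours); lane certificate] -/
theorem srwI_one_bounds (hd : 3 ≤ d) (hd' : d ≤ 21) (hcs : ∀ i, coordD x i = ((cs.getD i 0 : ℕ) : ℤ))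
    (hlen : cs.length = d) (K : ℕ) {lo hi l0 : ℚ} (hlo : lo ≤ partialQAt d K cs) (hhi : partialQAt d K cs ≤ hi)
    (hl0 : l0 ≤ GreenCert.partialQ d K) :
    ((lo : ℚ) : ℝ) ≤ srwI d 1 0 x ∧ srwI d 1 0 x ≤ ((hi + ((GreenCert.cert d).B - l0) : ℚ) : ℝ) := by
  have hlo' : ((lo : ℚ) : ℝ) ≤ ((partialQAt d K cs : ℚ) : ℝ) := by exact_mod_cast hlo
  have hhi' : ((partialQAt d K cs : ℚ) : ℝ) ≤ ((hi : ℚ) : ℝ) := by exact_mod_cast hhi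
  have hl0' : ((l0 : ℚ) : ℝ) ≤ ((GreenCert.partialQ d K : ℚ) : ℝ) := by exact_mod_cast hl0
  have h := srwI_one_le_partialQAt_add hd hcs hlen K
  have hB := GreenCert.srwI_one_le_certB hd hd'
  refine ⟨hlo'.trans (partialQAt_le_srwI_one hd hcs hlen K), ?_⟩
  push_cast
  linarith

/-- **Enclosure of `G(0)` from a decided head literal**: `l0 ≤ partialQ d K` and `G(0) ≤ B_d` (`3 ≤ d ≤ 21`) give
`l0 ≤ G(0) ≤ B_d`.
[cite: HaraSladeSokal1993, Appendix A.1 Table 4 p. 28 (C₀(0,0;1/2d)); lane certificate] -/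
theorem srwI_one_zero_bounds (hd : 3 ≤ d) (hd' : d ≤ 21) (K : ℕ) {l0 : ℚ} (hl0 : l0 ≤ GreenCert.partialQ d K) :
    ((l0 : ℚ) : ℝ) ≤ srwI d 1 0 (0 : Fin d → ℤ) ∧ srwI d 1 0 (0 : Fin d → ℤ) ≤ ((GreenCert.cert d).B : ℝ) := by
  have hl0' : ((l0 : ℚ) : ℝ) ≤ ((GreenCert.partialQ d K : ℚ) : ℝ) := by exact_mod_cast hl0
  have h1 := partialQ_cast_le_sum_range (d := d) K (N := 2 * K) le_rfl
  have h2 := srwI_one_eq_sum_add hd 0 (2 * K) (0 : Fin d → ℤ)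
  simp only [zero_add] at h2
  have h3 := srwI_nonneg (d := d) 1 (by omega) (2 * K) (0 : Fin d → ℤ)
  exact ⟨by linarith, GreenCert.srwI_one_le_certB hd hd'⟩

end GreenNbhd

end Literature.Probability.RandomPlanarGeometry.SAW.Zd.LoopErasure
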